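import Literature.Probability.RandomPlanarGeometry.LSW2004UST
import Literature.Probability.RandomPlanarGeometry.DiscCycle
import HarnessLib

/-!
# [LSW04] p. 981, "Theorem 4.4 implies that the law of `W` converges weakly to the law of `B(8t)`": the implication

G. F. Lawler, O. Schramm, W. Werner, *Conformal invariance of planar loop-erased random walks and
uniform spanning trees*, Ann. Probab. **32** (2004) 939–995 (**[LSW04]**). The named fact
`USTPeano.drivingProcess_tendsto` (`LSW2004UST.lean`) is the sentence of the proof of
Thms. 4.7/4.8 (p. 981) quoted in the title, for the UST Peano curves of the grid approximations
`D^{Rₙ}` of a smooth domain (§4.3). Theorem 4.4 itself (p. 976) is a COUPLING statement about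
one lattice domain `D ∈ 𝔇*` with `rad₀(D) > r₁` and `ℌ_D(0, α) ∈ [ε₁, 1 - ε₁]`; LSW pass from
it to that sentence in three silent steps: (i) `rad₀(D^{Rₙ}) → ∞`; (ii) the harmonic measure
from `0` of the wired arc of `D^{Rₙ}` stays inside `(0, 1)`, which they take from
"`lim_{R → ∞} R⁻¹ φ_R⁻¹(z) = φ⁻¹(z)` uniformly in `ℍ̄` (this follows, e.g., from Cor. 2.4 in
[Po])" (p. 977); (iii) couplings `ε₂`-close on `[0, T]` outside probability `ε₃`, for all
`T, ε₂, ε₃`, give weak convergence on `C([0, ∞))` — (iii) is proved in the tree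
(`Process.tendstoInDistribution_of_coupling`, `tendstoInDistribution_of_thm44_shape`).

This file PROVES the implication, with the two printed inputs as hypotheses and no new named
fact: `USTPeano.drivingProcess_tendsto_of_thm44`. Steps (i), (ii) are proved here:
`Domain.norm_sub_boundaryVerts_le_one`, `Domain.exists_mem_range_dist_le_two` (every point of
`∂D(α, β, a, b)` is within `2` of the polyline `α` or `β`), `IsApproximation.le_norm_of_mem_frontier`
(`|z| ≥ R m_D - 13` on `∂D^R`), `eventually_ball_subset_carrier` (i); `tendsto_symm_zero`,
`exists_eventually_arg_mem` (ii). The harmonic-measure hypothesis of Thm. 4.4 is rendered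
through the normalised map `φ` (`a ↦ 0`, `b ↦ ∞`, `|φ(0)| = 1`): by conformal invariance
`ℌ_D(0, ·)` of the boundary arc from `a` to `b` through `α` is the harmonic measure in `ℍ` from
`φ(0)` of `[0, ∞)`, i.e. `1 - arg(φ(0))/π`; the printed `α` omits the two half-diagonals
`[a, α_a]`, `[α_b, b]` of that arc, of harmonic measure `O(rad₀(D)^{-1/2})` from `0` (Beurling),
so under "∀ ε₁ ∃ r₁" both readings state the same theorem (and LSW's proof uses the hypothesis
only through "`φ(0)` close to `i`" plus a change of base point, p. 976).

What then remains of `drivingProcess_tendsto` is exactly Thm. 4.4 (the UST/LERW theory of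
[LSW04] §4.1–4.2 and §5: Wilson's algorithm, the Dirichlet–Neumann approximation Prop. 4.1, the
key estimate Prop. 4.2, Skorokhod embedding — not in the tree) and the boundary-uniform
convergence of the Riemann maps of the approximations (Pommerenke 1992, Cor. 2.4).
-/

noncomputable section

open Set Function Filter MeasureTheory Complex Metric
open _root_.Topology
open UpperHalfPlane (upperHalfPlaneSet)
open scoped NNReal ENNReal unitInterval BoundedContinuousFunction Real

namespace Literature.Probability.RandomPlanarGeometry

open scoped PathBorel

namespace USTPeano

/-! ### Step (i): the boundary polygon of `D(α, β, a, b)` and the inner radius of the approximations -/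

namespace Domain

variable (Δ : Domain)

/-- **Consecutive boundary vertices of `D(α, β, a, b)` are at distance `≤ 1`**: along `α` and
`β` they are adjacent lattice points (distance `1`), and the four junction half-diagonals at `a`,
`b` have length `√2/4`. [folklore] -/
theorem norm_sub_boundaryVerts_le_one (k : ℕ) (hk : k < (boundaryVerts Δ.α Δ.β Δ.a Δ.b).length) :
    ‖(boundaryVerts Δ.α Δ.β Δ.a Δ.b)[(k + 1) % (boundaryVerts Δ.α Δ.β Δ.a Δ.b).length]'(Nat.mod_lt _
        (by simp)) - (boundaryVerts Δ.α Δ.β Δ.a Δ.b)[k]‖ ≤ 1 := by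
  refine boundaryVerts_cyclic' (R := fun u v ↦ ‖v - u‖ ≤ 1) Δ.α_ne_nil Δ.β_ne_nil
    ?_ ?_ ?_ ?_ ?_ ?_ k hk
  · rw [Δ.head_α, ← norm_neg, neg_sub]; exact norm_peanoPt_sub_primalPt_le _
  · refine Δ.isChain_α.imp fun p q h ↦ ?_
    rw [← dist_eq_norm, dist_comm, dist_primalPt_of_latticeAdj h]
  · rw [Δ.getLast_α]; exact norm_peanoPt_sub_primalPt_le _
  · rw [Δ.getLast_β, ← norm_neg, neg_sub]; exact norm_peanoPt_sub_dualPt_le _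
  · refine Δ.isChain_β.imp fun u v h ↦ ?_
    rw [← dist_eq_norm, dist_dualPt_of_latticeAdj h]
  · rw [Δ.head_β]; exact norm_peanoPt_sub_dualPt_le _

/-- Every point of `∂D(α, β, a, b)` is within distance `1` of a boundary vertex (it lies on an
edge of length `≤ 1`). [folklore] -/
theorem exists_boundaryVerts_dist_le {z : ℂ} (hz : z ∈ frontier Δ.carrier) :
    ∃ v ∈ boundaryVerts Δ.α Δ.β Δ.a Δ.b, dist z v ≤ 1 := by
  have hne : boundaryVerts Δ.α Δ.β Δ.a Δ.b ≠ [] := by simp [boundaryVerts]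
  rw [Δ.frontier_carrier, range_polygonLoop hne, mem_iUnion] at hz
  obtain ⟨k, hk⟩ := hz
  refine ⟨(boundaryVerts Δ.α Δ.β Δ.a Δ.b)[(k : ℕ)], List.getElem_mem k.2, ?_⟩
  have hsub : segment ℝ ((boundaryVerts Δ.α Δ.β Δ.a Δ.b)[(k : ℕ)])
      ((boundaryVerts Δ.α Δ.β Δ.a Δ.b)[((k : ℕ) + 1) % (boundaryVerts Δ.α Δ.β Δ.a Δ.b).length]'
        (Nat.mod_lt _ k.pos)) ⊆ closedBall ((boundaryVerts Δ.α Δ.β Δ.a Δ.b)[(k : ℕ)]) 1 := by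
    refine (convex_closedBall _ _).segment_subset (mem_closedBall_self zero_le_one) ?_
    rw [mem_closedBall, dist_eq_norm]
    exact Δ.norm_sub_boundaryVerts_le_one k k.2
  exact hsub hk

/-- The points of a list lie on its polyline `pathCurve`. [folklore] -/
theorem mem_range_pathCurve {L : List ℂ} {p : ℂ} (hp : p ∈ L) : p ∈ Set.range (pathCurve L) := by
  obtain ⟨i, hi, rfl⟩ := List.getElem_of_mem hp
  rcases Nat.lt_or_ge 1 L.length with h2 | h1
  · have h2' : (1 : ℝ) < L.length := by exact_mod_cast h2
    have hpos : (0 : ℝ) < (L.length : ℝ) - 1 := by linarith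
    have hi' : (i : ℝ) + 1 ≤ L.length := by exact_mod_cast hi
    have hle : (i : ℝ) / ((L.length : ℝ) - 1) ≤ 1 := by rw [div_le_one hpos]; linarith
    refine ⟨⟨(i : ℝ) / ((L.length : ℝ) - 1), div_nonneg (Nat.cast_nonneg _) hpos.le, hle⟩, ?_⟩
    rw [pathCurve_apply]
    change affineInterp L (((L.length : ℝ) - 1) * ((i : ℝ) / ((L.length : ℝ) - 1))) = L[i]
    have e : ((L.length : ℝ) - 1) * ((i : ℝ) / ((L.length : ℝ) - 1)) = i := by
      field_simp
    rw [e, affineInterp_natCast L i hi]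
  · have hlen : L.length = 1 := by omega
    refine ⟨0, ?_⟩
    rw [pathCurve_apply, Set.Icc.coe_zero, mul_zero]
    have h0 := affineInterp_natCast L 0 (by omega)
    rw [Nat.cast_zero] at h0
    exact h0.trans (getElem_congr_idx (by omega))

/-- Every boundary vertex of `D(α, β, a, b)` is within distance `1` of the polyline `α` or the
polyline `β` (the vertices of `α`, `β` lie on them; `a`, `b` are within `√2/4` of `α_a`, `α_b`).
[folklore] -/
theorem exists_mem_range_dist_le_of_mem_boundaryVerts {v : ℂ}
    (hv : v ∈ boundaryVerts Δ.α Δ.β Δ.a Δ.b) :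
    ∃ c ∈ Set.range (pathCurve (Δ.α.map primalPt)) ∪ Set.range (pathCurve (Δ.β.map dualPt)),
      dist v c ≤ 1 := by
  rcases mem_boundaryVerts_iff.1 hv with h | h | h | h
  · refine ⟨primalPt (Δ.α.head Δ.α_ne_nil), Or.inl (mem_range_pathCurve
      (List.mem_map.2 ⟨_, List.head_mem Δ.α_ne_nil, rfl⟩)), ?_⟩
    rw [h, Δ.head_α, dist_eq_norm]
    exact norm_peanoPt_sub_primalPt_le _
  · exact ⟨v, Or.inl (mem_range_pathCurve h), by rw [dist_self]; exact zero_le_one⟩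
  · refine ⟨primalPt (Δ.α.getLast Δ.α_ne_nil), Or.inl (mem_range_pathCurve
      (List.mem_map.2 ⟨_, List.getLast_mem Δ.α_ne_nil, rfl⟩)), ?_⟩
    rw [h, Δ.getLast_α, dist_eq_norm]
    exact norm_peanoPt_sub_primalPt_le _
  · exact ⟨v, Or.inr (mem_range_pathCurve h), by rw [dist_self]; exact zero_le_one⟩

/-- **Every point of `∂D(α, β, a, b)` is within distance `2` of the polyline `α` or `β`.**
[folklore] -/
theorem exists_mem_range_dist_le_two {z : ℂ} (hz : z ∈ frontier Δ.carrier) :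
    ∃ c ∈ Set.range (pathCurve (Δ.α.map primalPt)) ∪ Set.range (pathCurve (Δ.β.map dualPt)),
      dist z c ≤ 2 := by
  obtain ⟨v, hv, hzv⟩ := Δ.exists_boundaryVerts_dist_le hz
  obtain ⟨c, hc, hvc⟩ := Δ.exists_mem_range_dist_le_of_mem_boundaryVerts hv
  exact ⟨c, hc, (dist_triangle z v c).trans (by linarith)⟩

/-- **Inside test for discs**: if `0 ∈ D` and every point of `∂D` has norm `≥ r`, then
`B(0, r) ⊆ D` (the disc is connected, meets `D` and misses `∂D`). [folklore] -/
theorem ball_subset_carrier {r : ℝ} (h0 : (0 : ℂ) ∈ Δ.carrier)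
    (h : ∀ z ∈ frontier Δ.carrier, r ≤ ‖z‖) : ball (0 : ℂ) r ⊆ Δ.carrier := by
  rcases le_or_gt r 0 with hr | hr
  · rw [Metric.ball_eq_empty.2 hr]; exact empty_subset _
  refine (convex_ball (0 : ℂ) r).isPreconnected.subset_left_of_subset_union Δ.isOpen_carrier
    isClosed_closure.isOpen_compl
    (disjoint_compl_right.mono_right (compl_subset_compl.2 subset_closure)) ?_
    ⟨0, mem_ball_self hr, h0⟩
  intro w hw
  by_contra hw'
  simp only [mem_union, mem_compl_iff, not_or, not_not] at hw'
  have h1 := h w (by rw [Δ.isOpen_carrier.frontier_eq]; exact ⟨hw'.2, hw'.1⟩)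
  rw [mem_ball_zero_iff] at hw
  linarith

end Domain

/-- The boundary loop of a smooth domain stays at distance `≥ m > 0` from the interior point `0`.
[folklore] -/
theorem SmoothDomain.exists_pos_le_norm_boundary (D : SmoothDomain) :
    ∃ m : ℝ, 0 < m ∧ ∀ t, m ≤ ‖D.toMarkedDomain.boundary t‖ := by
  obtain ⟨m, hm, hball⟩ := Metric.isOpen_iff.1 D.toMarkedDomain.isOpen 0 D.zero_mem
  refine ⟨m, hm, fun t ↦ ?_⟩
  refine le_of_not_gt fun h ↦ ?_
  have hmem : D.toMarkedDomain.boundary t ∈ D.toMarkedDomain.carrier := hball (mem_ball_zero_iff.2 h)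
  have hfr := D.toMarkedDomain.boundary_mem_frontier t
  rw [D.toMarkedDomain.isOpen.frontier_eq] at hfr
  exact hfr.2 hmem

/-- A point of a curve at reparametrisation distance `≤ 10` from `R · arc`, where the arc stays
at distance `≥ m` from `0` and `R ≥ 0`, has norm `≥ R m - 11`. [folklore] -/
theorem le_norm_of_reparamDist_le {γ arc : Curve ℂ} {R m : ℝ}
    (hd : Curve.reparamDist γ (scaleCurve R arc) ≤ 10) (harc : ∀ t, m ≤ ‖arc t‖) (hR : 0 ≤ R)
    {c : ℂ} (hc : c ∈ Set.range γ) : R * m - 11 ≤ ‖c‖ := by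
  obtain ⟨t, rfl⟩ := hc
  have h1 : infDist (γ t) (scaleCurve R arc).range < 11 :=
    ((Curve.infDist_range_le γ _ t).trans hd).trans_lt (by norm_num)
  obtain ⟨w, hw, hdist⟩ := (Metric.infDist_lt_iff (scaleCurve R arc).range_nonempty).1 h1
  simp only [Curve.range, Set.mem_range] at hw
  obtain ⟨s, rfl⟩ := hw
  have h2 : R * m ≤ ‖scaleCurve R arc s‖ := by
    rw [scaleCurve_apply, norm_mul, Complex.norm_real, Real.norm_of_nonneg hR]
    exact mul_le_mul_of_nonneg_left (harc s) hR
  have h3 := norm_sub_norm_le (scaleCurve R arc s) (γ t)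
  rw [← dist_eq_norm, dist_comm] at h3
  linarith

/-- **The boundary of an approximation `D^R` is far from `0`**: if the boundary loop of `D` stays
at distance `≥ m` from `0` and `R ≥ 0`, every point of `∂D^R` has norm `≥ R m - 13` (it is within
`2` of the polyline `α^R` or `β^R`, which are within `ρ ≤ 10` of `R α_D`, `R β_D ⊆ R ∂D`).
[LSW04] §4.3 (the approximations have `rad₀(D^R) → ∞`, used silently on p. 981).
[cite: LawlerSchrammWerner2004, §4.3] -/
theorem IsApproximation.le_norm_of_mem_frontier {D : SmoothDomain} {R : ℝ} {Δ : Domain}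
    (h : IsApproximation D R Δ) {m : ℝ} (hm : ∀ t, m ≤ ‖D.toMarkedDomain.boundary t‖)
    (hR : 0 ≤ R) {z : ℂ} (hz : z ∈ frontier Δ.carrier) : R * m - 13 ≤ ‖z‖ := by
  obtain ⟨c, hc, hzc⟩ := Δ.exists_mem_range_dist_le_two hz
  have hA : ∀ t, m ≤ ‖D.arcA t‖ := fun t ↦ by rw [SmoothDomain.arcA_apply]; exact hm _
  have hB : ∀ t, m ≤ ‖D.arcB t‖ := fun t ↦ by rw [SmoothDomain.arcB_apply]; exact hm _
  have hc' : R * m - 11 ≤ ‖c‖ := hc.elim (le_norm_of_reparamDist_le h.1 hA hR)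
    (le_norm_of_reparamDist_le h.2.1 hB hR)
  have h3 := norm_sub_norm_le c z
  rw [← dist_eq_norm, dist_comm] at h3
  linarith

/-- **Step (i): `rad₀(D^{Rₙ}) → ∞`.** Along approximations at scales `Rₙ → ∞`, every disc
`B(0, r)` is eventually contained in `D^{Rₙ}`. [LSW04] p. 981 (hypothesis `rad₀(D) > r₁` of
Thm. 4.4 for the approximations). [cite: LawlerSchrammWerner2004, §4.3] -/
theorem eventually_ball_subset_carrier (D : SmoothDomain) {R : ℕ → ℝ} {Δ : ℕ → Domain}
    (hR : Tendsto R atTop atTop) (hΔ : ∀ n, IsApproximation D (R n) (Δ n)) (r : ℝ) :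
    ∀ᶠ n in atTop, ball (0 : ℂ) r ⊆ (Δ n).carrier := by
  obtain ⟨m, hm, hmb⟩ := D.exists_pos_le_norm_boundary
  filter_upwards [hR.eventually_ge_atTop (max 0 ((r + 13) / m))] with n hn
  have hR0 : 0 ≤ R n := le_trans (le_max_left _ _) hn
  have hRm : r + 13 ≤ R n * m := by
    have := le_trans (le_max_right _ _) hn
    rwa [div_le_iff₀ hm] at this
  refine (Δ n).ball_subset_carrier (hΔ n).2.2 fun z hz ↦ ?_
  have := (hΔ n).le_norm_of_mem_frontier hmb hR0 hz
  linarith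

/-! ### Step (ii): the normalised maps and the harmonic measure from `0` -/

/-- **The normalised map of a smooth domain exists**: a chordal uniformizing map `φ : ℍ → D`
(`0 ↦ a`, `∞ ↦ b`; Riemann + Carathéodory, proved in the tree) precomposed with the dilation
making `|φ⁻¹(0)| = 1` ([LSW04] §4.3, p. 977: "Let `φ : D → ℍ` be the conformal homeomorphism
satisfying `φ(a) = 0`, `φ(b) = ∞` and `|φ(0)| = 1`"). [cite: LawlerSchrammWerner2004, §4.3] -/
theorem SmoothDomain.exists_isLSWMap (D : SmoothDomain) :
    ∃ φ : ConformalEquiv upperHalfPlaneSet D.toMarkedDomain.carrier,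
      D.toMarkedDomain.IsChordalUniformizing φ ∧ ‖φ.symm 0‖ = 1 := by
  obtain ⟨φ, hφ⟩ := MarkedDomain.exists_isChordalUniformizing_holds D.toMarkedDomain
  have hmem : φ.symm 0 ∈ upperHalfPlaneSet := φ.symm_mapsTo D.zero_mem
  have hne : φ.symm 0 ≠ 0 := by
    intro h
    have : (0 : ℝ) < (φ.symm 0).im := hmem
    rw [h, Complex.zero_im] at this
    exact lt_irrefl _ this
  set c : ℝ := ‖φ.symm 0‖ with hc
  have hcpos : 0 < c := norm_pos_iff.2 hne
  refine ⟨(ConformalEquiv.smulUpperHalfPlane c hcpos).trans φ, hφ.smul_trans c hcpos, ?_⟩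
  change ‖(ConformalEquiv.smulUpperHalfPlane c hcpos).symm (φ.symm 0)‖ = 1
  rw [ConformalEquiv.smulUpperHalfPlane_symm_apply, norm_smul, norm_inv, Real.norm_eq_abs,
    abs_of_pos hcpos, ← hc, inv_mul_cancel₀ hcpos.ne']

section Maps

variable {D : SmoothDomain} {R : ℕ → ℝ} {Δ : ℕ → Domain}
  {φD : ConformalEquiv upperHalfPlaneSet D.toMarkedDomain.carrier}
  {φ : ∀ n, ConformalEquiv upperHalfPlaneSet (Δ n).carrier}

/-- **`φ_{Rₙ}(0) → φ(0)`** (in the tree's orientation: `(φ n)⁻¹(0) → φ_D⁻¹(0)`): if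
`Rₙ⁻¹ φₙ → φ_D` uniformly on `ℍ` ([LSW04] p. 977) then the preimages of `0` converge, by
continuity of `φ_D⁻¹` at `0 ∈ D`. [cite: LawlerSchrammWerner2004, §4.3] -/
theorem tendsto_symm_zero (h0 : ∀ n, (0 : ℂ) ∈ (Δ n).carrier)
    (hconv : TendstoUniformlyOn (fun n z ↦ ((R n : ℂ))⁻¹ * φ n z) φD atTop upperHalfPlaneSet) :
    Tendsto (fun n ↦ (φ n).symm 0) atTop (𝓝 (φD.symm 0)) := by
  have hw : ∀ n, (φ n).symm 0 ∈ upperHalfPlaneSet := fun n ↦ (φ n).symm_mapsTo (h0 n)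
  have hφw : ∀ n, φ n ((φ n).symm 0) = 0 := fun n ↦ (φ n).apply_symm_apply (h0 n)
  have h1 : Tendsto (fun n ↦ φD ((φ n).symm 0)) atTop (𝓝 0) := by
    rw [Metric.tendsto_nhds]
    intro ε hε
    filter_upwards [(Metric.tendstoUniformlyOn_iff.1 hconv) ε hε] with n hn
    have := hn _ (hw n)
    rwa [hφw n, mul_zero] at this
  have h2 : Tendsto (fun n ↦ φD ((φ n).symm 0)) atTop (𝓝[D.toMarkedDomain.carrier] 0) :=
    tendsto_nhdsWithin_iff.2 ⟨h1, Eventually.of_forall fun n ↦ φD.mapsTo (hw n)⟩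
  have h3 : ContinuousWithinAt φD.symm D.toMarkedDomain.carrier 0 :=
    φD.symm.continuousOn 0 D.zero_mem
  have h4 : Tendsto (fun n ↦ φD.symm (φD ((φ n).symm 0))) atTop (𝓝 (φD.symm 0)) :=
    h3.tendsto.comp h2
  have h5 : (fun n ↦ φD.symm (φD ((φ n).symm 0))) = fun n ↦ (φ n).symm 0 :=
    funext fun n ↦ φD.symm_apply_apply (hw n)
  rwa [h5] at h4

/-- **Step (ii): the harmonic measure hypothesis of Thm. 4.4 holds along the approximations.**
With `φ_D⁻¹(0) ∈ ℍ` of argument `θ ∈ (0, π)` and `φ_{Rₙ}⁻¹(0) → φ_D⁻¹(0)`, eventually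
`arg φ_{Rₙ}⁻¹(0) ∈ [ε₁π, (1 - ε₁)π]` for `ε₁ = min(θ, π - θ)/(2π)`; i.e. the harmonic measure
from `0` of the wired arc of `D^{Rₙ}` stays in `[ε₁, 1 - ε₁]`. [LSW04] p. 981 with p. 977.
[cite: LawlerSchrammWerner2004, Thm. 4.4] -/
theorem exists_eventually_arg_mem (h0 : ∀ n, (0 : ℂ) ∈ (Δ n).carrier)
    (hconv : TendstoUniformlyOn (fun n z ↦ ((R n : ℂ))⁻¹ * φ n z) φD atTop upperHalfPlaneSet) :
    ∃ ε₁ : ℝ, 0 < ε₁ ∧ ∀ᶠ n in atTop,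
      ε₁ * π ≤ arg ((φ n).symm 0) ∧ arg ((φ n).symm 0) ≤ (1 - ε₁) * π := by
  have him : 0 < (φD.symm 0).im := φD.symm_mapsTo D.zero_mem
  set θ : ℝ := arg (φD.symm 0) with hθ
  have hθ0 : 0 < θ := by
    refine lt_of_le_of_ne (Complex.arg_nonneg_iff.2 him.le) fun h ↦ ?_
    exact him.ne' (Complex.arg_eq_zero_iff.1 h.symm).2
  have hθπ : θ < π := by
    refine lt_of_le_of_ne (Complex.arg_le_pi _) fun h ↦ ?_
    exact him.ne' (Complex.arg_eq_pi_iff.1 h).2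
  have hcont : ContinuousAt arg (φD.symm 0) :=
    Complex.continuousAt_arg (Complex.mem_slitPlane_iff.2 (Or.inr him.ne'))
  have hlim : Tendsto (fun n ↦ arg ((φ n).symm 0)) atTop (𝓝 θ) :=
    hcont.tendsto.comp (tendsto_symm_zero h0 hconv)
  refine ⟨min θ (π - θ) / (2 * π), div_pos (lt_min hθ0 (sub_pos.2 hθπ)) (by positivity), ?_⟩
  have hmem : Ioo (θ / 2) ((θ + π) / 2) ∈ 𝓝 θ := Ioo_mem_nhds (by linarith) (by linarith)
  filter_upwards [hlim.eventually hmem] with n hn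
  have hπ : 0 < π := Real.pi_pos
  have e1 : min θ (π - θ) / (2 * π) * π = min θ (π - θ) / 2 := by
    field_simp
  have e2 : (1 - min θ (π - θ) / (2 * π)) * π = π - min θ (π - θ) / 2 := by
    field_simp
  rw [e1, e2]
  constructor
  · linarith [min_le_left θ (π - θ), hn.1]
  · linarith [min_le_right θ (π - θ), hn.2]

end Maps

/-! ### The implication -/

/-- **[LSW04] p. 981: "Theorem 4.4 implies that the law of `W` converges weakly to the law of
`B(8t)`", proved from the two printed inputs.** `h44` = **Thm. 4.4 as printed** (p. 976): "For
every positive `ε₁, ε₂, ε₃` and `t̄`, there is some positive `r₁ = r₁(ε₁, ε₂, ε₃, t̄)` such that the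
following holds. Let `D = D(α, β, a, b) ∈ 𝔇*` satisfy `rad₀(D) > r₁` and
`ℌ_D(0, α) ∈ [ε₁, 1 - ε₁]`. Let `γ` be [the] corresponding UST Peano path, let `φ : D → ℍ` denote
the conformal map which takes `a` to `0`, `b` to `∞` and satisfies `|φ(0)| = 1`, let `γ̂ := φ ∘ γ`,
parameterized according to capacity from `∞`, and let `W(t)` denote the Loewner driving process
for `γ̂`. Then there is a coupling of standard Brownian motion `B` and `W` such that
`P[sup{|W(t) - B(8t)| : t ∈ [0, t̄]} > ε₂] < ε₃`" — for the simple-path class `USTPeano.Domain`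
with `0 ∈ D`; `rad₀(D) = inf{|z| : z ∉ D} > r₁` rendered as `B(0, r₁) ⊆ D` (equivalent under
`∃ r₁`); the harmonic-measure condition as `arg φ(0) ∈ [ε₁π, (1 - ε₁)π]` (module docstring);
universal over the normalised maps and capacity images (both unique); the coupling a measure on
pairs of paths with marginals the law of `W` and the law of `B(8·)` of the canonical Brownian
motion. `hconv` = p. 977: "`lim_{R → ∞} R⁻¹ φ_R⁻¹(z) = φ⁻¹(z)`, uniformly in `ℍ̄`" for the
normalised maps `φ_R` of the approximations `D^R` and `φ` of `D` (the tree's maps go `ℍ → D^R`,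
so this reads `Rₙ⁻¹ φₙ → φ_D` uniformly on `ℍ`), "e.g., from Cor. 2.4 in [Pommerenke 1992]".
Proof: (i) `eventually_ball_subset_carrier`, (ii) `exists_eventually_arg_mem`, (iii)
`tendstoInDistribution_of_thm44_shape` (with `map_brownianTimeEight_eq`: the law of `B(8·)` is
that of `√8 B`) and the portmanteau equivalence with bounded continuous test functions.
[cite: LawlerSchrammWerner2004, Thm. 4.4] -/
theorem drivingProcess_tendsto_of_thm44
    (h44 : ∀ (ε₁ ε₂ ε₃ T : ℝ), 0 < ε₁ → 0 < ε₂ → 0 < ε₃ → 0 < T → ∃ r₁ : ℝ, ∀ (Δ : Domain),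
      (0 : ℂ) ∈ Δ.carrier → ball (0 : ℂ) r₁ ⊆ Δ.carrier →
      ∀ (φ : ConformalEquiv upperHalfPlaneSet Δ.carrier), Δ.IsLSWMap φ →
        ε₁ * π ≤ arg (φ.symm 0) → arg (φ.symm 0) ≤ (1 - ε₁) * π →
        ∀ (Γ : PeanoPath Δ → C(ℝ≥0, ℂ)) (W : PeanoPath Δ → C(ℝ≥0, ℝ)),
          (∀ γ, IsCapacityImage Δ φ γ (Γ γ) (W γ)) →
          ∃ ρ : Measure (C(ℝ≥0, ℝ) × C(ℝ≥0, ℝ)), ρ.fst = (ustLaw Δ).map W ∧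
            ρ.snd = Process.preWienerMeasure.map brownianTimeEight ∧
            ρ {p | ∃ t : ℝ≥0, (t : ℝ) ≤ T ∧ ε₂ < dist (p.1 t) (p.2 t)} < ENNReal.ofReal ε₃)
    (hconv : ∀ (D : SmoothDomain) (R : ℕ → ℝ) (Δ : ℕ → Domain), Tendsto R atTop atTop →
      (∀ n, IsApproximation D (R n) (Δ n)) →
      ∀ (φD : ConformalEquiv upperHalfPlaneSet D.toMarkedDomain.carrier),
        D.toMarkedDomain.IsChordalUniformizing φD → ‖φD.symm 0‖ = 1 →
        ∀ (φ : ∀ n, ConformalEquiv upperHalfPlaneSet (Δ n).carrier),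
          (∀ n, (Δ n).IsLSWMap (φ n)) →
          TendstoUniformlyOn (fun n z ↦ ((R n : ℂ))⁻¹ * φ n z) φD atTop upperHalfPlaneSet) :
    drivingProcess_tendsto := by
  intro D R Δ hR hΔ hne φ Γ W hφΓW f
  classical
  haveI : Fact Process.isProjectiveLimit_preWienerMeasure := ⟨isProjectiveLimit_preWienerMeasure_holds'⟩
  haveI : ∀ n, IsProbabilityMeasure (ustLaw (Δ n)) := fun n ↦ inferInstance
  have h0 : ∀ n, (0 : ℂ) ∈ (Δ n).carrier := fun n ↦ (hΔ n).2.2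
  have hφ : ∀ n, (Δ n).IsLSWMap (φ n) := fun n ↦ (hφΓW n).1
  have hΓW : ∀ n γ, IsCapacityImage (Δ n) (φ n) γ (Γ n γ) (W n γ) := fun n ↦ (hφΓW n).2
  -- (ii) the harmonic measure condition along the sequence
  obtain ⟨φD, hφD, hφD1⟩ := D.exists_isLSWMap
  obtain ⟨ε₁, hε₁, harg⟩ :=
    exists_eventually_arg_mem h0 (hconv D R Δ hR hΔ φD hφD hφD1 φ hφ)
  have hWm : ∀ n, AEMeasurable (W n) (ustLaw (Δ n)) := fun n ↦
    (Measurable.of_discrete).aemeasurable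
  -- Thm. 4.4 eventually applies: couplings in the shape of `tendstoInDistribution_of_thm44_shape`
  have h44' : ∀ (T ε₂ ε₃ : ℝ), 0 < ε₂ → 0 < ε₃ → ∀ᶠ n in atTop,
      ∃ ρ : Measure (C(ℝ≥0, ℝ) × C(ℝ≥0, ℝ)), ρ.fst = (ustLaw (Δ n)).map (W n) ∧
        ρ.snd = Process.preWienerMeasure.map (drivingPath 8) ∧
        ρ {p | ∃ t : ℝ≥0, (t : ℝ) ≤ T ∧ ε₂ ≤ dist (p.1 t) (p.2 t)} < ENNReal.ofReal ε₃ := by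
    intro T ε₂ ε₃ hε₂ hε₃
    obtain ⟨r₁, hr₁⟩ := h44 ε₁ (ε₂ / 2) ε₃ (max T 1) hε₁ (half_pos hε₂) hε₃
      (lt_of_lt_of_le one_pos (le_max_right _ _))
    filter_upwards [eventually_ball_subset_carrier D hR hΔ r₁, harg] with n hball hn
    obtain ⟨ρ, h1, h2, h3⟩ :=
      hr₁ (Δ n) (h0 n) hball (φ n) (hφ n) hn.1 hn.2 (Γ n) (W n) (hΓW n)
    refine ⟨ρ, h1, by rw [h2, map_brownianTimeEight_eq], lt_of_le_of_lt (measure_mono ?_) h3⟩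
    rintro p ⟨t, ht, hd⟩
    exact ⟨t, ht.trans (le_max_left _ _), by linarith⟩
  -- (iii) convergence in distribution of the driving functions to `√8 B`
  have hlaw : TendstoInDistribution W atTop (drivingPath 8) (fun n ↦ ustLaw (Δ n))
      Process.preWienerMeasure :=
    tendstoInDistribution_of_thm44_shape hWm h44'
  -- weak convergence tested on the bounded continuous `f`
  have key := (ProbabilityMeasure.tendsto_iff_forall_integral_tendsto.1 hlaw.tendsto) f
  have h1 : ∀ n, ∫ x, f x ∂((ustLaw (Δ n)).map (W n)) = ∫ γ, f (W n γ) ∂ustLaw (Δ n) := fun n ↦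
    integral_map (hWm n) f.continuous.aestronglyMeasurable
  have h2 : ∫ x, f x ∂(Process.preWienerMeasure.map (drivingPath 8)) =
      ∫ ω, f (brownianTimeEight ω) ∂Process.preWienerMeasure := by
    rw [← map_brownianTimeEight_eq,
      integral_map measurable_brownianTimeEight.aemeasurable f.continuous.aestronglyMeasurable]
  simp only [ProbabilityMeasure.coe_mk, h1, h2] at key
  exact key

end USTPeano

end Literature.Probability.RandomPlanarGeometry
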